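import Mathlib
import Literature.Geometry.Lorentzian.StaticMasslessVlasovShell

/-!
# Sketch — first lemmas for the crux-ideate cards of ideator k = 2 on `StarvedNecks.NeckGapDecay`
(crux item stmt-FinalStateConjecture-16768, round 1).

Card `apex-incoming-field`:
* `apexField_outgoing` — the Kirchhoff integrand `ψ + σ(∂ₜ + w·∇)ψ = L_x(σ_x ψ)` VANISHES identically on
  content outgoing from the apex (`ψ = F(t − s)/s` along the generator): the two terms cancel.
* `ShellMeanInvCube` (named classical fact, potential theory): the exact sphere average of `‖y‖⁻³`
  over the sphere `S(x, s)`, `s > ‖x‖`: `⨍ ‖x + s w‖⁻³ dw = 1 / (s (s² − ‖x‖²))`.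
* `TailCouplingBound` (named fact, calculus): the solid-cone Duhamel weight of the Kerr tail
  `V = M‖y‖⁻³` seen from a gap apex `x`, with the unknown region cut at radius `R` (`0 < R ≤ ‖x‖ = a`):
  `∫_{a+R}^{S} M/(s² − a²) ds ≤ (M/(2a)) log((2a+R)/R)` and
  `∫_0^{a−R} M s/(a(a² − s²)) ds = (M/(2a)) log(a²/(R(2a−R)))` — i.e. the secular logarithm is
  `log(a/R)`, and it is killed by the prefactor `M/a ≤ M/R`.

Card `virial-floor-weak-lump`:
* `photonSphere_dichotomy` — at a photon sphere (`μ' r = 1`) of a static spherically symmetric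
  spacetime with `μ' = (m + 4πr³p)/(r(r−2m))`: `3m/r + 4πr²p = 1`, hence `2m/r ≥ 1/3 ∨ 4πr²p ≥ 1/2`
  (self-bound null matter is never weak-field at its trapping radius);
* `shell_photonSphere_dichotomy` — the same read on the tree's Andréasson shells (`StaticMasslessVlasovShell`).
-/

noncomputable section

set_option linter.dupNamespace false

open Real MeasureTheory Set

namespace Summit.FinalStateConjecture.FinalStateConjecture.Cruxes.NeckGapDecay.IdeateK2

/-! ## Card `apex-incoming-field` -/

/-- Outgoing-from-the-apex content is invisible to the Kirchhoff integrand: along the generator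
`s ↦ (t − s, x + s w)` an outgoing wave is `ψ = F(t − s)/s`, so `σ_x ψ = F(t − s)` and
`∂ₛ(σψ) + σ ∂ₜψ = −F' + σ (F'/σ) = 0`. -/
theorem apexField_outgoing (F : ℝ → ℝ) (F' t σ : ℝ) (hσ : σ ≠ 0)
    (hF : HasDerivAt F F' (t - σ)) :
    HasDerivAt (fun s ↦ F (t - s)) (-F') σ ∧
      HasDerivAt (fun t' ↦ F (t' - σ) / σ) (F' / σ) t ∧ (-F') + σ * (F' / σ) = 0 := by
  refine ⟨hF.comp_const_sub t σ, (hF.comp_sub_const t σ).div_const σ, ?_⟩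
  field_simp
  ring

/-- Named classical fact (potential theory; the shell formula `dA = 2π s r dr / ‖x‖` for the
distribution of `‖y‖` on the sphere `S(x,s)`): for `s > ‖x‖ > 0` the sphere average of `‖y‖⁻³`
is `1/(s(s² − ‖x‖²))` exactly. Stated with Mathlib's sphere measure `volume.toSphere`, as in the
landed Kirchhoff formula of the sibling crux (`…Theorems.StarvedNecksNecksCertifyKirchhoffHuygens`). -/
def ShellMeanInvCube : Prop :=
  ∀ (x : EuclideanSpace ℝ (Fin 3)) (s : ℝ), 0 < ‖x‖ → ‖x‖ < s →
    (((volume : Measure (EuclideanSpace ℝ (Fin 3))).toSphere univ).toReal)⁻¹ *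
        ∫ (w : Metric.sphere (0 : EuclideanSpace ℝ (Fin 3)) 1), ‖x + s • (w : EuclideanSpace ℝ (Fin 3))‖⁻¹ ^ 3
          ∂((volume : Measure (EuclideanSpace ℝ (Fin 3))).toSphere)
      = 1 / (s * (s ^ 2 - ‖x‖ ^ 2))

/-- Named calculus fact: the solid-cone Duhamel weight `∫ s ⨍_{S(x,s)} 1_{‖y‖ ≥ R} M‖y‖⁻³ ds` of the
Kerr tail, seen from an apex at radius `a = ‖x‖ ≥ R`, is `≤ (M/a)(C + log(a/R))`: spheres not
surrounding the origin contribute `(M/(2a)) log(a²/(R(2a−R)))`, spheres surrounding it contribute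
`≤ (M/(2a)) log((2a+R)/R)` however far (`S`) the cone is continued — no `log S`, no `log ρ`. -/
def TailCouplingBound : Prop :=
  ∀ (M a R S : ℝ), 0 ≤ M → 0 < R → R ≤ a → a + R ≤ S →
    (∫ s in (a + R)..S, M / (s ^ 2 - a ^ 2)) ≤ M / (2 * a) * Real.log ((2 * a + R) / R) ∧
    (∫ s in (0 : ℝ)..(a - R), M * s / (a * (a ^ 2 - s ^ 2))) = M / (2 * a) * Real.log (a ^ 2 / (R * (2 * a - R)))

/-! ## Card `virial-floor-weak-lump` -/

/-- At a photon sphere of a static spherically symmetric spacetime (`μ' = 1/r`, with Andréasson's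
`μ' = (m + 4πr³p)/(r(r − 2m))`): `3m/r + 4πr²p = 1`; hence either the compactness is already
`2m/r ≥ 1/3` or the radial pressure is huge, `4πr²p ≥ 1/2`. Either way the configuration is not
weak-field: trapped null matter cannot hide under a `1/10` `C⁰` threshold. -/
theorem photonSphere_dichotomy {r m p : ℝ} (hr : 0 < r) (hm : 2 * m < r) (hp : 0 ≤ p)
    (h : (m + 4 * π * r ^ 3 * p) / (r * (r - 2 * m)) = 1 / r) :
    3 * m / r + 4 * π * r ^ 2 * p = 1 ∧ (1 / 3 ≤ 2 * m / r ∨ 1 / 2 ≤ 4 * π * r ^ 2 * p) := by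
  have hr2 : 0 < r - 2 * m := by linarith
  have hne : r * (r - 2 * m) ≠ 0 := by positivity
  have key : m + 4 * π * r ^ 3 * p = r - 2 * m := by
    have := h
    rw [div_eq_div_iff hne hr.ne'] at this
    have h2 : (m + 4 * π * r ^ 3 * p) * r = (r - 2 * m) * r := by nlinarith [this]
    exact mul_right_cancel₀ hr.ne' h2
  have main : 3 * m / r + 4 * π * r ^ 2 * p = 1 := by
    field_simp
    nlinarith [key]
  refine ⟨main, ?_⟩
  by_contra hcon
  simp only [not_or, not_le] at hcon
  obtain ⟨h1, h2⟩ := hcon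
  have : 3 * m / r < 1 / 2 := by
    have : 3 * m / r = (3 / 2) * (2 * m / r) := by ring
    rw [this]; linarith
  linarith

open Literature.Geometry.Lorentzian in
/-- The same dichotomy read on the tree's static massless Vlasov shells (Andréasson 2021): at any
radius `r > 2M₀` where `μ' = 1/r` (a circular null geodesic of the shell spacetime),
`3 m(r)/r + 4π r² p(r) = 1` with `p` the cut-off radial pressure. -/
theorem shell_photonSphere_dichotomy
    {M₀ : ℝ} (S : StaticMasslessVlasovShell M₀) {r : ℝ} (hr : 2 * M₀ < r)
    (hμ : HasDerivAt S.μ (1 / r) r) :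
    3 * S.m r / r + 4 * π * r ^ 2 * S.p r = 1 ∧
      (1 / 3 ≤ 2 * S.m r / r ∨ 1 / 2 ≤ 4 * π * r ^ 2 * S.p r) := by
  have hr0 : 0 < r := by linarith [S.M₀_pos]
  have h := (S.hasDerivAt_μ r hr).unique hμ
  have hp : 0 ≤ S.p r := S.p_nonneg r
  exact IdeateK2.photonSphere_dichotomy hr0 (S.two_mul_m_lt r hr) hp h

end Summit.FinalStateConjecture.FinalStateConjecture.Cruxes.NeckGapDecay.IdeateK2
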